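import Summits.AnomalousDissipation.AnomalousDissipation.Theorems.KolmogorovFloor.Negative.CheapBaseKill
import Summits.AnomalousDissipation.AnomalousDissipation.Theorems.KolmogorovFloor.Negative.BelowTaylorSupport
import Summits.AnomalousDissipation.AnomalousDissipation.Theorems.KolmogorovFloor.Negative.Rest

/-!
# CHEAP approximate steady Euler states kill the Kolmogorov floor (negative side of `KolmogorovFloor`)

cdisprove seat `refuter-cdisprove-stmt-AnomalousDissipation-14030-0` (2026-08-16). The endgame `A′` of the
round-2 card `Ideas/cheap-steady-euler-closure.md` (crux-ideate r2 k4) over the kernel `cheap_base_kill`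
(`Negative/CheapBaseKill.lean`), with the card's exponents: if for every `η ∈ (0,1)` the force `f` admits a
smooth solenoidal mean-zero state `a` with enstrophy and energy `≤ η^{-11/10}`, slope `Σ_{|k|≤N}|k|‖â(k)‖ ≤
η^{-3/5}` (all `N`), work `|(a,f)| ≤ η^{2/5}` and steady-Euler defect `|((a·∇)a − f, W)| ≤ η·max|k|‖Ŵ(k)‖`
against every band-limited solenoidal `W`, then NO Kolmogorov-class floor family exists for `f`
(`floor_false_of_cheapStates`; `ν := η^{3/2}`: `den ≤ (4π²+1)η^{9/10}`, `Π ≤ 800π²(1+2Θ)C′²η^{-3/4}`,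
`den·Π = O(η^{3/20}) → 0`). Hence `kolmogorovFloor_false_of_cheapStates`: CHEAP for every admissible force
refutes the crux BY NAME — the crux is reduced, in Lean, to a ν-free statement about steady Euler
(the card's `CheapSteadyEulerStates`; DRESSED-RAY-r1-3 supplies it on paper for trig-poly forces with a
non-resonant shear frame via the inviscid linear response, the card for all smooth forces via lacunary frames).
-/

noncomputable section

open MeasureTheory UnitAddTorus Matrix
open scoped InnerProductSpace ENNReal ComplexConjugate

namespace Summit.AnomalousDissipation.AnomalousDissipation.Theorems.KolmogorovFloor.Negative

open Literature.Analysis.FunctionSpaces Literature.Analysis.FluidPDE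
open Summit.AnomalousDissipation.AnomalousDissipation.Theorems.TaylorCertificatePair.Negative


/-- `x ≤ t` from `x^γ`-root bookkeeping: if `0 < η ≤ t^{1/γ}` then `η^γ ≤ t` (re-export shape of
`rpow_le_of_le_root` with the threshold read off a `min`). -/
theorem rpow_le_of_le_min_root {η t γ b : ℝ} (hη : 0 < η) (ht : 0 < t) (hγ : 0 < γ) (hb : η ≤ b)
    (hbt : b ≤ t ^ (1 / γ)) : η ^ γ ≤ t :=
  rpow_le_of_le_root hη ht hγ (hb.trans hbt)

set_option maxHeartbeats 400000 in
/-- **CHEAP states kill the Kolmogorov floor family of their force** (module docstring). -/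
theorem floor_false_of_cheapStates {f : (UnitAddTorus (Fin 3)) → (EuclideanSpace ℝ (Fin 3))} (hf : Torus.IsSmooth f) {η₀ : ℝ} (hη₀ : 0 < η₀)
    (hcheap : ∀ η : ℝ, 0 < η → η < η₀ → ∃ a : (UnitAddTorus (Fin 3)) → (EuclideanSpace ℝ (Fin 3)), Torus.IsSmooth a ∧ Torus.IsDivFree a ∧ Torus.HasZeroMean a ∧
      (Torus.eGradNormSq a).toReal ≤ η ^ (-(11 / 10 : ℝ)) ∧ (∫ x, ‖a x‖ ^ 2) ≤ η ^ (-(11 / 10 : ℝ)) ∧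
      (∀ N : ℕ, ∑ κ ∈ Torus.freqBall N, Real.sqrt (Torus.freqNormSq κ) * ‖mFourierCoeff (EuclideanSpace.complexify ∘ a) κ‖ ≤
        η ^ (-(3 / 5 : ℝ))) ∧
      |∫ x, ⟪a x, f x⟫_ℝ| ≤ η ^ (2 / 5 : ℝ) ∧
      ∀ (N : ℕ) (W : (UnitAddTorus (Fin 3)) → (EuclideanSpace ℝ (Fin 3))) (M : ℝ), Torus.IsSmooth W → Torus.IsDivFree W → Torus.HasZeroMean W →
        (∀ κ, (N : ℝ) ^ 2 < Torus.freqNormSq κ → mFourierCoeff (EuclideanSpace.complexify ∘ W) κ = 0) →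
        (∀ κ, Real.sqrt (Torus.freqNormSq κ) * ‖mFourierCoeff (EuclideanSpace.complexify ∘ W) κ‖ ≤ M) →
        |∫ x, ⟪Torus.convect a a x - f x, W x⟫_ℝ| ≤ η * M)
    {ε₀ C Θ ν₀ : ℝ} (hε₀ : 0 < ε₀) (hν₀ : 0 < ν₀)
    (hfloor : ∀ ν : ℝ, 0 < ν → ν < ν₀ →
      ∃ (N : ℕ) (Φ₁ : Torus.CylindricalTest (Fin 3)) (θ₁ : ℝ), (N : ℝ) ≤ C * ν ^ (-(3 / 4 : ℝ)) ∧
        (∀ i, Torus.fourierTruncate N (Φ₁.g i) = Φ₁.g i) ∧ -Θ ≤ θ₁ ∧ θ₁ ≤ 0 ∧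
        ∀ u : Torus.energySpace (Fin 3),
          let uf : (UnitAddTorus (Fin 3)) → (EuclideanSpace ℝ (Fin 3)) := ((u : (Lp (EuclideanSpace ℝ (Fin 3)) 2 (volume : Measure (UnitAddTorus (Fin 3))))) : (UnitAddTorus (Fin 3)) → (EuclideanSpace ℝ (Fin 3)));
          let D : ℝ := ν * (Torus.eGradNormSq uf).toReal;
          let P : ℝ := Torus.pairing (u : (Lp (EuclideanSpace ℝ (Fin 3)) 2 (volume : Measure (UnitAddTorus (Fin 3))))) f - D;
          Torus.eGradNormSq uf ≠ ⊤ → ‖u‖ ^ 2 ≤ 16 * (∫ x, ‖f x‖ ^ 2) / ν ^ 2 →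
            ε₀ ≤ D + Torus.nsGeneratorPairing ν f u (Φ₁.grad u) + 2 * θ₁ * P) :
    False := by
  have hF2nn : 0 ≤ ∫ x, ‖f x‖ ^ 2 := integral_nonneg fun x => by positivity
  by_cases hF0 : ∫ x, ‖f x‖ ^ 2 = 0
  · obtain ⟨N, Φ₁, θ₁, -, -, -, -, hu⟩ := hfloor (ν₀ / 2) (by positivity) (by linarith)
    have hinj := rest_injects (by positivity : (0 : ℝ) < ν₀ / 2) hu
    have hae := ae_zero_of_integral_sq_zero hf hF0
    have hzero : (∫ x, ⟪f x, Φ₁.grad 0 x⟫_ℝ) = 0 := by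
      rw [← integral_zero (α := (UnitAddTorus (Fin 3))) (G := ℝ)]
      refine integral_congr_ae ?_
      filter_upwards [hae] with x hx
      simp [hx]
    linarith
  have hF2 : 0 < ∫ x, ‖f x‖ ^ 2 := lt_of_le_of_ne hF2nn (Ne.symm hF0)
  obtain ⟨F2, hF2def⟩ : ∃ F2 : ℝ, F2 = ∫ x, ‖f x‖ ^ 2 := ⟨_, rfl⟩
  rw [← hF2def] at hF2
  /- thresholds (with `Θ⁺ = max Θ 0`, `C' = max C 1`) -/
  obtain ⟨Θ', hΘ'⟩ : ∃ Θ' : ℝ, Θ' = max Θ 0 := ⟨_, rfl⟩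
  have hΘ'0 : 0 ≤ Θ' := by rw [hΘ']; exact le_max_right _ _
  obtain ⟨C', hC'⟩ : ∃ C' : ℝ, C' = max C 1 := ⟨_, rfl⟩
  have hC'1 : 1 ≤ C' := by rw [hC']; exact le_max_right _ _
  obtain ⟨K₂, hK₂def⟩ : ∃ K₂ : ℝ, K₂ = (4 * Real.pi ^ 2 + 1) * (800 * Real.pi ^ 2 * (1 + 2 * Θ') * C' ^ 2) := ⟨_, rfl⟩
  have hK₂ : 0 < K₂ := by rw [hK₂def]; positivity
  obtain ⟨ρ₁, hρ₁⟩ : ∃ ρ₁ : ℝ, ρ₁ = ε₀ / (4 * (4 * (1 + 2 * Θ') + 2 * Θ' + 1)) := ⟨_, rfl⟩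
  have hρ₁0 : 0 < ρ₁ := by rw [hρ₁]; positivity
  obtain ⟨ρ₂, hρ₂⟩ : ∃ ρ₂ : ℝ, ρ₂ = ε₀ / (3 * K₂) := ⟨_, rfl⟩
  have hρ₂0 : 0 < ρ₂ := by rw [hρ₂]; positivity
  obtain ⟨ρ₃, hρ₃⟩ : ∃ ρ₃ : ℝ, ρ₃ = 1 / (5 * (4 * Real.pi ^ 2 + 1)) := ⟨_, rfl⟩
  have hρ₃0 : 0 < ρ₃ := by rw [hρ₃]; positivity
  obtain ⟨ρ₄, hρ₄⟩ : ∃ ρ₄ : ℝ, ρ₄ = 16 * F2 / 10 := ⟨_, rfl⟩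
  have hρ₄0 : 0 < ρ₄ := by rw [hρ₄]; positivity
  obtain ⟨m, hmdef⟩ : ∃ m : ℝ, m = min (min (min (min ν₀ η₀) 1) (min (ρ₁ ^ (1 / (2 / 5 : ℝ))) (ρ₂ ^ (1 / (3 / 20 : ℝ)))))
      (min (ρ₃ ^ (1 / (9 / 10 : ℝ))) (ρ₄ ^ (1 / (19 / 10 : ℝ)))) := ⟨_, rfl⟩
  have hm0 : 0 < m := by
    rw [hmdef]
    exact lt_min (lt_min (lt_min (lt_min hν₀ hη₀) one_pos) (lt_min (Real.rpow_pos_of_pos hρ₁0 _) (Real.rpow_pos_of_pos hρ₂0 _)))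
      (lt_min (Real.rpow_pos_of_pos hρ₃0 _) (Real.rpow_pos_of_pos hρ₄0 _))
  obtain ⟨η, hηdef⟩ : ∃ η : ℝ, η = m / 2 := ⟨_, rfl⟩
  have hη : 0 < η := by rw [hηdef]; positivity
  have hηm : η < m := by rw [hηdef]; linarith
  have hm1 : m ≤ min (min (min ν₀ η₀) 1) (min (ρ₁ ^ (1 / (2 / 5 : ℝ))) (ρ₂ ^ (1 / (3 / 20 : ℝ)))) := by rw [hmdef]; exact min_le_left _ _
  have hm2 : m ≤ min (ρ₃ ^ (1 / (9 / 10 : ℝ))) (ρ₄ ^ (1 / (19 / 10 : ℝ))) := by rw [hmdef]; exact min_le_right _ _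
  have hην₀ : η < ν₀ := hηm.trans_le (((hm1.trans (min_le_left _ _)).trans (min_le_left _ _)).trans (min_le_left _ _))
  have hηη₀ : η < η₀ := hηm.trans_le (((hm1.trans (min_le_left _ _)).trans (min_le_left _ _)).trans (min_le_right _ _))
  have hη1 : η < 1 := hηm.trans_le ((hm1.trans (min_le_left _ _)).trans (min_le_right _ _))
  have hηρ₁ : η ^ (2 / 5 : ℝ) ≤ ρ₁ :=
    rpow_le_of_le_min_root hη hρ₁0 (by norm_num) hηm.le ((hm1.trans (min_le_right _ _)).trans (min_le_left _ _))
  have hηρ₂ : η ^ (3 / 20 : ℝ) ≤ ρ₂ :=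
    rpow_le_of_le_min_root hη hρ₂0 (by norm_num) hηm.le ((hm1.trans (min_le_right _ _)).trans (min_le_right _ _))
  have hηρ₃ : η ^ (9 / 10 : ℝ) ≤ ρ₃ :=
    rpow_le_of_le_min_root hη hρ₃0 (by norm_num) hηm.le (hm2.trans (min_le_left _ _))
  have hηρ₄ : η ^ (19 / 10 : ℝ) ≤ ρ₄ :=
    rpow_le_of_le_min_root hη hρ₄0 (by norm_num) hηm.le (hm2.trans (min_le_right _ _))
  /- the viscosity `ν = η^{3/2}` -/
  obtain ⟨ν, hνdef⟩ : ∃ ν : ℝ, ν = η ^ (3 / 2 : ℝ) := ⟨_, rfl⟩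
  have hν : 0 < ν := by rw [hνdef]; exact Real.rpow_pos_of_pos hη _
  have hνη : ν ≤ η := by rw [hνdef]; exact Real.rpow_le_self_of_le_one hη.le hη1.le (by norm_num)
  have hνν₀ : ν < ν₀ := hνη.trans_lt hην₀
  have hν1 : ν ≤ 1 := hνη.trans hη1.le
  /- the certificate and the cheap state -/
  obtain ⟨N, Φ₁, θ₁, hN, hband, hθ₁, hθ₁', hu⟩ := hfloor ν hν hνν₀
  have hΘ : 0 ≤ Θ := by linarith only [hθ₁, hθ₁']
  have hΘeq : Θ' = Θ := by rw [hΘ']; exact max_eq_left hΘ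
  rw [hΘeq] at hK₂def hρ₁
  obtain ⟨a, ha, had, haz, hEa, hAa, hSa, hPa, hdef⟩ := hcheap η hη hηη₀
  /- rpow identities -/
  have e1 : ν * η ^ (-(11 / 10 : ℝ)) = η ^ (2 / 5 : ℝ) := by
    rw [hνdef, ← Real.rpow_add hη]; norm_num
  have e2 : ν * η ^ (-(3 / 5 : ℝ)) = η ^ (9 / 10 : ℝ) := by
    rw [hνdef, ← Real.rpow_add hη]; norm_num
  have e3 : ν ^ (-(3 / 4 : ℝ)) = η ^ (-(9 / 8 : ℝ)) := by
    rw [hνdef, ← Real.rpow_mul hη.le]; norm_num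
  have e4 : ν * (η ^ (-(9 / 8 : ℝ)) * η ^ (-(9 / 8 : ℝ))) = η ^ (-(3 / 4 : ℝ)) := by
    rw [hνdef, ← Real.rpow_add hη, ← Real.rpow_add hη]; norm_num
  have e5 : η ^ (9 / 10 : ℝ) * η ^ (-(3 / 4 : ℝ)) = η ^ (3 / 20 : ℝ) := by
    rw [← Real.rpow_add hη]; norm_num
  have e6 : ν ^ 2 = η ^ (3 : ℝ) := by
    rw [hνdef, ← Real.rpow_natCast, ← Real.rpow_mul hη.le]; norm_num
  have e7 : η ^ (3 : ℝ) * η ^ (-(11 / 10 : ℝ)) = η ^ (19 / 10 : ℝ) := by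
    rw [← Real.rpow_add hη]; norm_num
  have hη09 : η ≤ η ^ (9 / 10 : ℝ) := Real.self_le_rpow_of_le_one hη.le hη1.le (by norm_num)
  have hηneg : 1 ≤ η ^ (-(11 / 10 : ℝ)) := Real.one_le_rpow_of_pos_of_le_one_of_nonpos hη hη1.le (by norm_num)
  /- (h1) quietness and work -/
  have h1 : (1 + 2 * Θ) * (ν * (4 * η ^ (-(11 / 10 : ℝ)))) + 2 * Θ * η ^ (2 / 5 : ℝ) ≤ ε₀ / 4 := by
    have e : (1 + 2 * Θ) * (ν * (4 * η ^ (-(11 / 10 : ℝ)))) + 2 * Θ * η ^ (2 / 5 : ℝ) =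
        (4 * (1 + 2 * Θ) + 2 * Θ) * η ^ (2 / 5 : ℝ) := by rw [← e1]; ring
    rw [e]
    have hle : η ^ (2 / 5 : ℝ) ≤ ε₀ / (4 * (4 * (1 + 2 * Θ) + 2 * Θ + 1)) := by rw [← hρ₁]; exact hηρ₁
    rw [le_div_iff₀ (by positivity)] at hle
    have h0 : 0 ≤ η ^ (2 / 5 : ℝ) := Real.rpow_nonneg hη.le _
    nlinarith only [hle, h0, hΘ]
  /- (h2) `den · Π ≤ ε₀/3` -/
  have hN0 : (0 : ℝ) ≤ N := Nat.cast_nonneg N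
  have hN' : (N : ℝ) ≤ C' * η ^ (-(9 / 8 : ℝ)) := by
    rw [← e3]
    exact hN.trans (mul_le_mul_of_nonneg_right (by rw [hC']; exact le_max_left _ _) (Real.rpow_nonneg hν.le _))
  have hη98 : 1 ≤ η ^ (-(9 / 8 : ℝ)) := Real.one_le_rpow_of_pos_of_le_one_of_nonpos hη hη1.le (by norm_num)
  have h4N : (((4 * N + 1 : ℕ)) : ℝ) ≤ 5 * (C' * η ^ (-(9 / 8 : ℝ))) := by
    push_cast
    have : (1 : ℝ) ≤ C' * η ^ (-(9 / 8 : ℝ)) := one_le_mul_of_one_le_of_one_le hC'1 hη98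
    linarith only [hN', this]
  have h4N2 : ν * (((4 * N + 1 : ℕ)) : ℝ) ^ 2 ≤ 25 * C' ^ 2 * η ^ (-(3 / 4 : ℝ)) := by
    have h0 : (0 : ℝ) ≤ (((4 * N + 1 : ℕ)) : ℝ) := Nat.cast_nonneg _
    calc ν * (((4 * N + 1 : ℕ)) : ℝ) ^ 2 ≤ ν * (5 * (C' * η ^ (-(9 / 8 : ℝ)))) ^ 2 :=
          mul_le_mul_of_nonneg_left (pow_le_pow_left₀ h0 h4N 2) hν.le
      _ = 25 * C' ^ 2 * (ν * (η ^ (-(9 / 8 : ℝ)) * η ^ (-(9 / 8 : ℝ)))) := by ring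
      _ = 25 * C' ^ 2 * η ^ (-(3 / 4 : ℝ)) := by rw [e4]
  have hden : 4 * Real.pi ^ 2 * ν * η ^ (-(3 / 5 : ℝ)) + η ≤ (4 * Real.pi ^ 2 + 1) * η ^ (9 / 10 : ℝ) := by
    have e : 4 * Real.pi ^ 2 * ν * η ^ (-(3 / 5 : ℝ)) = 4 * Real.pi ^ 2 * η ^ (9 / 10 : ℝ) := by rw [← e2]; ring
    rw [e]; nlinarith only [hη09, Real.pi_pos]
  have hden0 : 0 ≤ 4 * Real.pi ^ 2 * ν * η ^ (-(3 / 5 : ℝ)) + η := by positivity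
  have h2 : (4 * Real.pi ^ 2 * ν * η ^ (-(3 / 5 : ℝ)) + η) *
      (32 * Real.pi ^ 2 * (1 + 2 * Θ) * ν * (((4 * N + 1 : ℕ)) : ℝ) ^ 2) ≤ ε₀ / 3 := by
    have hPi : 32 * Real.pi ^ 2 * (1 + 2 * Θ) * ν * (((4 * N + 1 : ℕ)) : ℝ) ^ 2 ≤
        800 * Real.pi ^ 2 * (1 + 2 * Θ) * C' ^ 2 * η ^ (-(3 / 4 : ℝ)) := by
      have := mul_le_mul_of_nonneg_left h4N2 (by positivity : (0 : ℝ) ≤ 32 * Real.pi ^ 2 * (1 + 2 * Θ))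
      linarith only [this]
    have hPi0 : 0 ≤ 32 * Real.pi ^ 2 * (1 + 2 * Θ) * ν * (((4 * N + 1 : ℕ)) : ℝ) ^ 2 := by positivity
    calc _ ≤ ((4 * Real.pi ^ 2 + 1) * η ^ (9 / 10 : ℝ)) * (800 * Real.pi ^ 2 * (1 + 2 * Θ) * C' ^ 2 * η ^ (-(3 / 4 : ℝ))) :=
          mul_le_mul hden hPi hPi0 (by positivity)
      _ = K₂ * (η ^ (9 / 10 : ℝ) * η ^ (-(3 / 4 : ℝ))) := by rw [hK₂def]; ring
      _ = K₂ * η ^ (3 / 20 : ℝ) := by rw [e5]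
      _ ≤ K₂ * ρ₂ := mul_le_mul_of_nonneg_left hηρ₂ hK₂.le
      _ = ε₀ / 3 := by rw [hρ₂]; field_simp
  /- (h3) `5 den ≤ 1` -/
  have h3 : 5 * (4 * Real.pi ^ 2 * ν * η ^ (-(3 / 5 : ℝ)) + η) ≤ 1 := by
    have hle : η ^ (9 / 10 : ℝ) ≤ 1 / (5 * (4 * Real.pi ^ 2 + 1)) := by rw [← hρ₃]; exact hηρ₃
    rw [le_div_iff₀ (by positivity)] at hle
    nlinarith only [hden, hle, Real.pi_pos]
  /- the Leray ball -/
  have hball : 2 * (∫ x, ‖a x‖ ^ 2) + 8 ≤ 16 * (∫ x, ‖f x‖ ^ 2) / ν ^ 2 := by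
    rw [← hF2def, e6, le_div_iff₀ (Real.rpow_pos_of_pos hη _)]
    have hle : η ^ (19 / 10 : ℝ) ≤ 16 * F2 / 10 := by rw [← hρ₄]; exact hηρ₄
    have h3pos : 0 ≤ η ^ (3 : ℝ) := Real.rpow_nonneg hη.le _
    have hA : (2 * (∫ x, ‖a x‖ ^ 2) + 8) * η ^ (3 : ℝ) ≤ 10 * (η ^ (3 : ℝ) * η ^ (-(11 / 10 : ℝ))) := by
      have : 2 * (∫ x, ‖a x‖ ^ 2) + 8 ≤ 10 * η ^ (-(11 / 10 : ℝ)) := by linarith only [hAa, hηneg]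
      have := mul_le_mul_of_nonneg_right this h3pos
      linarith only [this]
    rw [e7] at hA
    linarith only [hA, hle]
  /- the kill -/
  refine cheap_base_kill hf hν Φ₁ hband hθ₁ hθ₁' hε₀ ha had haz (Ea := η ^ (-(11 / 10 : ℝ))) (Sa := η ^ (-(3 / 5 : ℝ)))
    (Pa := η ^ (2 / 5 : ℝ)) (η := η) hEa (hSa N) (Real.rpow_nonneg hη.le _) hPa hη.le (hdef N) h1 h2 h3 hball ?_
  intro u hfin hballu
  have h := hu u
  dsimp only at h
  exact h hfin hballu

/-- **The ν-free Euler statement the crux is reduced to** (the round-2 card's `CheapSteadyEulerStates`, typed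
against `cheap_base_kill`'s interface): every smooth solenoidal mean-zero force admits, for every `η ∈ (0,1)`,
a smooth solenoidal mean-zero state of enstrophy and energy `≤ η^{-11/10}` (for all `η` below some `η₀(f) > 0`), slope `≤ η^{-3/5}`, work `≤ η^{2/5}`
and steady-Euler defect `≤ η` in the beat-dual pairing against band-limited solenoidal multipliers. PAPER:
DRESSED-RAY-r1-3.md §§2–3 (trig-poly forces with a non-resonant shear frame: far-field Euler shear + inviscid
linear response), Ideas/cheap-steady-euler-closure.md (all smooth forces: lacunary tall frames). Not
constructible in the tree today (needs the per-mode-line Rayleigh solve). -/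
def CheapSteadyEulerStates : Prop :=
  ∀ f : (UnitAddTorus (Fin 3)) → (EuclideanSpace ℝ (Fin 3)), Torus.IsSmooth f → Torus.IsDivFree f → Torus.HasZeroMean f →
    ∃ η₀ : ℝ, 0 < η₀ ∧ ∀ η : ℝ, 0 < η → η < η₀ → ∃ a : (UnitAddTorus (Fin 3)) → (EuclideanSpace ℝ (Fin 3)), Torus.IsSmooth a ∧ Torus.IsDivFree a ∧ Torus.HasZeroMean a ∧
      (Torus.eGradNormSq a).toReal ≤ η ^ (-(11 / 10 : ℝ)) ∧ (∫ x, ‖a x‖ ^ 2) ≤ η ^ (-(11 / 10 : ℝ)) ∧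
      (∀ N : ℕ, ∑ κ ∈ Torus.freqBall N, Real.sqrt (Torus.freqNormSq κ) * ‖mFourierCoeff (EuclideanSpace.complexify ∘ a) κ‖ ≤
        η ^ (-(3 / 5 : ℝ))) ∧
      |∫ x, ⟪a x, f x⟫_ℝ| ≤ η ^ (2 / 5 : ℝ) ∧
      ∀ (N : ℕ) (W : (UnitAddTorus (Fin 3)) → (EuclideanSpace ℝ (Fin 3))) (M : ℝ), Torus.IsSmooth W → Torus.IsDivFree W → Torus.HasZeroMean W →
        (∀ κ, (N : ℝ) ^ 2 < Torus.freqNormSq κ → mFourierCoeff (EuclideanSpace.complexify ∘ W) κ = 0) →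
        (∀ κ, Real.sqrt (Torus.freqNormSq κ) * ‖mFourierCoeff (EuclideanSpace.complexify ∘ W) κ‖ ≤ M) →
        |∫ x, ⟪Torus.convect a a x - f x, W x⟫_ℝ| ≤ η * M

/-- **CHEAP approximate steady Euler states for every admissible force refute the crux BY NAME.** -/
theorem kolmogorovFloor_false_of_cheapStates
    (hCHEAP : ∀ f : (UnitAddTorus (Fin 3)) → (EuclideanSpace ℝ (Fin 3)), Torus.IsSmooth f → Torus.IsDivFree f → Torus.HasZeroMean f →
      ∃ η₀ : ℝ, 0 < η₀ ∧ ∀ η : ℝ, 0 < η → η < η₀ → ∃ a : (UnitAddTorus (Fin 3)) → (EuclideanSpace ℝ (Fin 3)), Torus.IsSmooth a ∧ Torus.IsDivFree a ∧ Torus.HasZeroMean a ∧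
        (Torus.eGradNormSq a).toReal ≤ η ^ (-(11 / 10 : ℝ)) ∧ (∫ x, ‖a x‖ ^ 2) ≤ η ^ (-(11 / 10 : ℝ)) ∧
        (∀ N : ℕ, ∑ κ ∈ Torus.freqBall N, Real.sqrt (Torus.freqNormSq κ) * ‖mFourierCoeff (EuclideanSpace.complexify ∘ a) κ‖ ≤
          η ^ (-(3 / 5 : ℝ))) ∧
        |∫ x, ⟪a x, f x⟫_ℝ| ≤ η ^ (2 / 5 : ℝ) ∧
        ∀ (N : ℕ) (W : (UnitAddTorus (Fin 3)) → (EuclideanSpace ℝ (Fin 3))) (M : ℝ), Torus.IsSmooth W → Torus.IsDivFree W → Torus.HasZeroMean W →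
          (∀ κ, (N : ℝ) ^ 2 < Torus.freqNormSq κ → mFourierCoeff (EuclideanSpace.complexify ∘ W) κ = 0) →
          (∀ κ, Real.sqrt (Torus.freqNormSq κ) * ‖mFourierCoeff (EuclideanSpace.complexify ∘ W) κ‖ ≤ M) →
          |∫ x, ⟪Torus.convect a a x - f x, W x⟫_ℝ| ≤ η * M) :
    ¬ Summit.AnomalousDissipation.AnomalousDissipation.Theses.TaylorCertificates.KolmogorovFloor := by
  rintro ⟨f, hfs, hfd, hfz, ε₀, C, Θ, ν₀, hε₀, hν₀, hfloor⟩
  obtain ⟨η₀, hη₀, hcheap⟩ := hCHEAP f hfs hfd hfz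
  exact floor_false_of_cheapStates hfs hη₀ hcheap hε₀ hν₀ hfloor

/-- **`¬ KolmogorovFloor` MODULO `CheapSteadyEulerStates`** (negative lemma modulo the ν-free Euler statement). -/
theorem kolmogorovFloor_false_of_CheapSteadyEulerStates (h : CheapSteadyEulerStates) :
    ¬ Summit.AnomalousDissipation.AnomalousDissipation.Theses.TaylorCertificates.KolmogorovFloor :=
  kolmogorovFloor_false_of_cheapStates h

end Summit.AnomalousDissipation.AnomalousDissipation.Theorems.KolmogorovFloor.Negative
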